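import Summits.HubbardSuperconductivity.HubbardSuperconductivity.Theorems.BalabanIRBirComplexStableXYRFluctuationSmallField
import Literature.Analysis.Matrix.FiniteRangeDecompositionPowSymmetry
import Literature.Probability.Distributions.MultivariateGaussianReindex
import HarnessLib

/-!
# Crux `BirComplexStableXYR` (stmt-HubbardSuperconductivity-14845): time-reflection symmetry (R) of
# the reference covariance and of its fluctuation fields

Support file (prover seat 1, route BalabanIR).  Hypothesis (R) of the crux (`c_{n∘R} = conj c_{−n}`,
`R` = time reflection of the window) makes `Re F` invariant under the time reflection
`ρ(x,t) = (x,−t)` of the space-time torus, hence the Hessian `H` of `Q_c` is `ρ`-INVARIANT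
(`cfrd_reflectionInvariant`: `H (ρ i) (ρ j) = H i j`; reindex the defining sum by
`(s,n) ↦ ((s.1, −s.2 − (r−1)), −n∘R)`, under which the window forms change sign, `cfrd_aform_reflect`,
and the coefficients are conjugated).  By functoriality of the finite-range pieces
(`Literature/Analysis/Matrix/FiniteRangeDecompositionPowSymmetry.lean`) every `t·C^{(m)}_N` inherits the
symmetry (`cfrd_frdPiecePow_reflect`), and by `Literature/Probability/Distributions/MultivariateGaussianReindex.lean`
the scale-`N` fluctuation law `N(0, t·C^{(m)}_N)` is preserved by the reflection `z ↦ z ∘ ρ`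
(**`birHessian_fluctuation_reflection`**, registered stub of this seat on the crux item): the
measure-preserving `Θ` that `pertZ_re_pos_of_reflection` (positivity of perturbed partition functions
for reflection-symmetric block data, `LocalPerturbationPositivity.lean`) requires — blueprint M5's
"real by (R) ⇒ Re Z > 0" at every single scale.  No definitions; sorry-free. [folklore]
-/

noncomputable section

namespace Summit.HubbardSuperconductivity.HubbardSuperconductivity.Theorems

set_option linter.dupNamespace false -- summit = problem name (single-conjunct summit), D-0017

open scoped BigOperators Matrix ComplexConjugate
open Complex Summit.HubbardSuperconductivity.BirComplexStableXYNegative MeasureTheory ProbabilityTheory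
open Literature.Probability.LatticeModels Literature.Analysis.Matrix Literature.Analysis.Fourier
open Literature.Probability.Distributions

section Reflection

variable {r : ℕ} {L M : ℕ} [NeZero L] [NeZero M]

-- The window linear form `a_{(s,n)}(j) = Σ_w n_w [sh s w = j]` (local abbreviation).
set_option quotPrecheck false in
local notation "aform[" L' "," M' "](" s "," n "," j ")" =>
  ∑ w, (((n w : ℤ) : ℝ) * (if sh L' M' s w = j then (1 : ℝ) else 0))

-- The inline Hessian matrix of `Q_c` (local abbreviation).
set_option quotPrecheck false in
local notation "Hm[" c' "," L' "," M' "]" => (Matrix.of fun i j : Λ L' M' =>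
  (-(∑ k : Λ L' M' × ↥((c' : Table _).support),
    (c' : Table _) k.2 * ((aform[L',M'](k.1, k.2.1, i) : ℝ) : ℂ)
      * ((aform[L',M'](k.1, k.2.1, j) : ℝ) : ℂ))).re)

/-! ## The reflected window and the reflected shift -/

omit [NeZero L] [NeZero M] in
/-- The temporal coordinate of the reflected window step: `rev w₃ = (r − 1) − w₃` in `ZMod M`. [folklore] -/
theorem cfrd_rev_cast (w₃ : Fin r) :
    (((Fin.rev w₃ : Fin r) : ℕ) : ZMod M) = ((r - 1 : ℕ) : ZMod M) - ((w₃ : ℕ) : ZMod M) := by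
  have hle : (w₃ : ℕ) ≤ r - 1 := by have := w₃.isLt; omega
  rw [Fin.val_rev, show r - ((w₃ : ℕ) + 1) = r - 1 - (w₃ : ℕ) by omega, Nat.cast_sub hle]

omit [NeZero L] [NeZero M] in
/-- **The reflected shift**: `sh (s.1, −s.2 − (r−1)) (w₁,w₂,rev w₃) = ρ (sh s w)`, `ρ(x,t) = (x,−t)`.
[folklore] -/
theorem cfrd_sh_reflect (s : Λ L M) (w : W r) :
    sh L M (s.1, -s.2 - ((r - 1 : ℕ) : ZMod M)) (w.1, w.2.1, Fin.rev w.2.2)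
      = ((sh L M s w).1, -(sh L M s w).2) := by
  simp only [sh, cfrd_rev_cast]
  ext <;> simp
  ring

omit [NeZero L] [NeZero M] in
/-- **The window forms change sign under the reflection**:
`a_{(s', −n∘R)}(ρ j) = −a_{(s,n)}(j)` with `s' = (s.1, −s.2 − (r−1))`. [folklore] -/
theorem cfrd_aform_reflect (s j : Λ L M) (n : Freq r) :
    aform[L,M]((s.1, -s.2 - ((r - 1 : ℕ) : ZMod M)), (fun w : W r => -(n (w.1, w.2.1, Fin.rev w.2.2))),
        (j.1, -j.2))
      = -aform[L,M](s, n, j) := by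
  -- reindex `w ↦ R w` (an involution of the window)
  set R : W r ≃ W r := Equiv.prodCongr (Equiv.refl _) (Equiv.prodCongr (Equiv.refl _) Fin.revPerm)
    with hRdef
  have hR : ∀ w : W r, R w = (w.1, w.2.1, Fin.rev w.2.2) := fun w => rfl
  rw [← Equiv.sum_comp R, ← Finset.sum_neg_distrib]
  refine Finset.sum_congr rfl fun w _ => ?_
  rw [hR]
  simp only [Fin.rev_rev, Int.cast_neg, neg_mul]
  congr 2
  -- `sh s' (R w) = ρ (sh s w)`, and `ρ` is injective
  rw [cfrd_sh_reflect s w]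
  by_cases h : sh L M s w = j
  · rw [if_pos h, if_pos]; rw [h]
  · rw [if_neg h, if_neg]
    intro h'
    apply h
    have h1 := congrArg Prod.fst h'
    have h2 := congrArg Prod.snd h'
    simp only [neg_inj] at h1 h2
    exact Prod.ext h1 h2

/-! ## Reflection invariance of the Hessian under (R) -/

/-- **(R) ⇒ the Hessian of `Q_c` is time-reflection invariant**: `H (ρ i) (ρ j) = H i j` for
`ρ(x,t) = (x,−t)`. [folklore] -/
theorem cfrd_reflectionInvariant (c : Table r)
    (hR : ∀ n : Freq r, c (fun w => n (w.1, w.2.1, Fin.rev w.2.2)) = (starRingEnd ℂ) (c (-n)))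
    (i j : Λ L M) :
    (Hm[c,L,M]) (i.1, -i.2) (j.1, -j.2) = (Hm[c,L,M]) i j := by
  classical
  simp only [Matrix.of_apply]
  -- the reflected frequency and its membership in the support
  set nrefl : Freq r → Freq r := fun n w => -(n (w.1, w.2.1, Fin.rev w.2.2)) with hnrefl
  have hc_nrefl : ∀ n : Freq r, c (nrefl n) = (starRingEnd ℂ) (c n) := by
    intro n
    have h := hR (-n)
    simp only [Pi.neg_apply, neg_neg] at h
    exact h
  have hnrefl_invol : ∀ n : Freq r, nrefl (nrefl n) = n := by
    intro n; funext w; simp [hnrefl, Fin.rev_rev]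
  have hmem : ∀ n : Freq r, n ∈ c.support → nrefl n ∈ c.support := by
    intro n hn
    rw [Finsupp.mem_support_iff] at hn ⊢
    rw [hc_nrefl]
    exact (_root_.map_ne_zero (starRingEnd ℂ)).2 hn
  -- the involution of the index set `Λ × supp c`
  set E : Λ L M × ↥c.support → Λ L M × ↥c.support := fun k =>
    ((k.1.1, -k.1.2 - ((r - 1 : ℕ) : ZMod M)), ⟨nrefl k.2, hmem _ k.2.2⟩) with hE
  have hEinv : Function.Involutive E := by
    intro k
    obtain ⟨s, n, hn⟩ := k
    simp only [hE]
    congr 1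
    · ext <;> simp
    · exact Subtype.ext (hnrefl_invol n)
  -- reindex the reflected sum by `E`
  set F : Λ L M × ↥c.support → ℂ := fun k => c k.2
      * ((aform[L,M](k.1, k.2.1, (i.1, -i.2)) : ℝ) : ℂ) * ((aform[L,M](k.1, k.2.1, (j.1, -j.2)) : ℝ) : ℂ)
    with hF
  set G : Λ L M × ↥c.support → ℂ := fun k => c k.2
      * ((aform[L,M](k.1, k.2.1, i) : ℝ) : ℂ) * ((aform[L,M](k.1, k.2.1, j) : ℝ) : ℂ) with hG
  have hFG : ∀ k, F (E k) = (starRingEnd ℂ) (G k) := by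
    intro k
    obtain ⟨s, n, hn⟩ := k
    simp only [hF, hG, hE, map_mul, Complex.conj_ofReal]
    rw [hc_nrefl]
    have h1 := cfrd_aform_reflect (L := L) (M := M) s i n
    have h2 := cfrd_aform_reflect (L := L) (M := M) s j n
    simp only [hnrefl] at h1 h2 ⊢
    rw [h1, h2]
    push_cast
    ring
  have hsum : ∑ k, F k = (starRingEnd ℂ) (∑ k, G k) := by
    rw [map_sum, ← Equiv.sum_comp hEinv.toPerm]
    exact Fintype.sum_congr _ _ fun k => hFG k
  show (-(∑ k, F k)).re = (-(∑ k, G k)).re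
  rw [hsum, ← map_neg, Complex.conj_re]

/-- **Every scale inherits (R)**: `(t·C^{(m)}_N) (ρ i) (ρ j) = (t·C^{(m)}_N) i j` for the smooth
finite-range pieces of the rescaled Hessian. [folklore] -/
theorem cfrd_frdPiecePow_reflect (c : Table r)
    (hR : ∀ n : Freq r, c (fun w => n (w.1, w.2.1, Fin.rev w.2.2)) = (starRingEnd ℂ) (c (-n)))
    (a t : ℝ) (m N : ℕ) (i j : Λ L M) :
    (t • frdPiecePow (a • Hm[c,L,M]) m N) ((Equiv.prodCongr (Equiv.refl (TorusSite 2 L)) (Equiv.neg (ZMod M))) i)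
        ((Equiv.prodCongr (Equiv.refl (TorusSite 2 L)) (Equiv.neg (ZMod M))) j)
      = (t • frdPiecePow (a • Hm[c,L,M]) m N) i j := by
  refine smul_frdPiecePow_apply_equiv _ (fun i j => ?_) t m N i j
  show (a • Hm[c,L,M]) (i.1, -i.2) (j.1, -j.2) = (a • Hm[c,L,M]) i j
  simp only [Matrix.smul_apply]
  rw [cfrd_reflectionInvariant c hR i j]

/-- **The scale-`N` fluctuation law is time-reflection invariant under (R) (registered stub
`birHessian_fluctuation_reflection` of prover seat 1 on crux 2R).** [folklore] -/
theorem birHessian_fluctuation_reflection : ∀ (r : ℕ) (c : Table r) (c₀ : ℝ), 2 ≤ r → 0 < c₀ → c.sum (fun _ a => a) = 0 → (∀ φ : W r → ℝ, c₀ * ∑ w, ∑ w', (1 - Real.cos (φ w - φ w')) ≤ (genF c φ).re) → (∀ n : Freq r, c (fun w => n (w.1, w.2.1, Fin.rev w.2.2)) = (starRingEnd ℂ) (c (-n))) → ∀ (L M : ℕ) [NeZero L] [NeZero M] (m N : ℕ) (t : ℝ), 0 ≤ t → MeasureTheory.MeasurePreserving (Literature.Probability.Distributions.reindexL (Equiv.prodCongr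 (Equiv.refl (Literature.Probability.LatticeModels.TorusSite 2 L)) (Equiv.neg (ZMod M)))) (ProbabilityTheory.multivariateGaussian 0 (t • Literature.Analysis.Matrix.frdPiecePow ((4 / (2 * normA c * (r : ℝ) ^ 3)) • (Matrix.of fun i j : Λ L M => (-(∑ k : Λ L M × ↥c.support, c k.2 * ((∑ w, ((k.2 : Freq r) w : ℝ) * (if sh L M k.1 w = i then (1 : ℝ) else 0) : ℝ) : ℂ) * ((∑ w, ((k.2 : Freq r) w : ℝ) * (if sh L M k.1 w = j then (1 : ℝ) else 0) : ℝ) : ℂ))).re)) m N)) (ProbabilityTheory.multivariateGaussian 0 (t • Literature.Analysis.Matrix.frdPiecePow ((4 / (2 * normA c * (r : ℝ) ^ 3)) • (Matrix.of fun i j : Λ L M => (-(∑ k : Λ L M × ↥c.support, c k.2 * ((∑ w, ((k.2 : Freq r) w : ℝ) * (if sh L M k.1 w = i then (1 : ℝ) else 0) : ℝ) : ℂ) * ((∑ w, ((k.2 : Freq r) w : ℝ) * (if sh L M k.1 w = j then (1 : ℝ) else 0) : ℝ) : ℂ))).re)) m N)) := by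
  intro r c c₀ hr hc₀ hN hC hR L M _ _ m N t ht
  have hS : (t • frdPiecePow ((4 / (2 * normA c * (r : ℝ) ^ 3)) • Hm[c,L,M]) m N).PosSemidef :=
    cfrd_smul_frdPiecePow_posSemidef hr c hc₀ hN hC m N ht
  exact measurePreserving_reindexL_multivariateGaussian hS _
    (fun i j => cfrd_frdPiecePow_reflect c hR _ t m N i j)

end Reflection

end Summit.HubbardSuperconductivity.HubbardSuperconductivity.Theorems

end
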